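import Summits.BirchSwinnertonDyer.BirchSwinnertonDyer.Theorems.SylvesterTwoHeegnerIndexCoupledTelescopeLevelData
import Summits.BirchSwinnertonDyer.BirchSwinnertonDyer.Theorems.SylvesterTwoHeegnerIndexCMHalfLevelPackage
import HarnessLib

/-!
# The COUPLED Cassels–Tate telescope, RESIDUE 7′ (VARIANT Q): the LEVEL DATA OF THE HALVED CLASS TERM at a general
# square-free conductor `9p·n₀` — `Q_{n₀}` is well-formed and `Γ_K`-invariant modulo `2^M` GRANTED THE TOWER FIXING
# (crux `UpperOffV0HSYPlus`, stmt-BirchSwinnertonDyer-19804)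

Skeleton VARIANT Q `Cruxes/UpperOffV0HSYPlus/Lines/coupled_variantQ.lean` d342db51dc602551, stub `stub_residueSevenHalved`
(RESIDUE 7′, rows `p ≡ 7 (9)`; planner D736/D759/D762 (3)/D789; memo `Cruxes/UpperOffV0HSYPlus/MInfinityAtThree-g44.md`
§4 (i)–(ii)).  This is the `p ≡ 7 (9)` twin of S1 `SylvesterTwoCMFlip.levelData_sylvesterTower` (p736223,
`…CoupledTelescopeLevelData`, whose eleven curve/level conjuncts it re-derives verbatim) for the HALVED Kolyvagin
system: the rows' class term at p ≡ 7 (9) is the CM-frame class of the HALF χ-sum `ψ_X(Σ_{i ∈ S₀} ρ_{tᵢ}^{1|2}(tᵢ • P))`,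
`P = κ⁻¹ ιe(D_l y)`, over a HALF TRANSVERSAL `t : ιt → Γ_K` — representatives of `Γ_K ⧸ N″`, `N″ ⊇ N₀` the fixer
of the fixed field `K[9p]^{⟨s⟩}` of the bottom involution `s` (CMHalf #S3 `exists_halfFixer`: `N₀ ≤ N″`, the
dichotomy «every `g ∈ N″` acts on `emb₀ K[9p]` as `1` or as `s`», `N″` fixes `v_B, v_A`, the product representatives
over `(𝒢₀⧸H) × H′` are bijective onto `Γ_K ⧸ N″`) — instead of representatives of `Γ_K ⧸ N₀` (memo §4 (i): over the
`s`-adapted transversal `S = S₀ ⊔ S₀φ` the full sum is `P_{n₀} = 2·Q_{n₀}`).  INPUT displayed as binders (never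
restated weaker, never proved here): THE TOWER FIXING at the level `N = 9p·n₀` — an automorphism `φ ∈ Aut_K K[N]`
restricting to `s` on `K[9p]` and FIXING HSY's CM point `y` of conductor `9p·n₀` (= (W2-b) `stub_levelFixingSeven`
at level `n₀` read through #S10c `SylvesterTwoCMHalf.decompFixing_of_involutionFixing`, which CONSTRUCTS such `φ`
for every Kolyvagin `n₀`).  Output (★ `levelDataHalved_sylvesterTower`): S1's conjuncts — the `σ_q` commute,
`σ_q^{q+1} = 1`, (ES1), `P ∈ E₉(K̄)^N`, (R5) on `N₀` (Gross 3.6, (T16)), `N ⊴ Γ_K`, `N₀`/`N` fix the cube roots,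
admissibility of `ψ_B(E₉(K̄)^N)`, `ψ_A(E₉(K̄)^N)` at `2^M` — AND the halved ones: (R5)″ EVERY `h ∈ N″` moves `P` by
`2^M·E₉(K̄)^N` (dichotomy: on `N₀` by Gross 3.6, on the coset `N₀φ̃` because a lift `φ̃ ∈ Γ_K` of `φ` FIXES `D_l y` —
`φ` commutes with the `σ_q` in the abelian `Gal(K[N]/K)`, tree `pointGalHom_foldr_derivOp_comm`; CMHalf #S4 §1
`exists_mem_zsmul_eq_smul_sub_of_dichotomy` at the modulus `2^M`), whence the two HALF χ-components
`ψ_B(Σᵢ ρ_{tᵢ}(tᵢ • P))`, `ψ_A(Σᵢ ρ²_{tᵢ}(tᵢ • P))` lie in `invPoints Γ_K · 2^M` (k-ty1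
`JZero.cubicTwist_chiComponent_fixedPoints_mem_invPoints` with `N′ := N″`) — i.e. the HALVED class terms
`c′_B^{(n₀)}, c′_A^{(n₀)}` are well-formed TREE TERMS at every level (memo §4 (ii): «`Q_n mod 2^{M(n)}` is
`𝒢_n`-invariant»; the n = ℓ, M = 1 instance is CMHalf #S4 `half_chiComponentA_mem_invPoints`).
* ★ `levelDataHalved_sylvesterTower` (one theorem; `γ D_l = D_l γ` is the tree's `pointGalHom_foldr_derivOp_comm`).
Theorems only (no definition / named fact / instance / notation); CONDITIONAL on the displayed tower-fixing binders
(cell lemma (W2-b), unrefereed; registered stub `stub_levelFixingSeven`); nothing asserted on 19804; no stub closed on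
the ledger; X12.CMAtTwo NOT proved; BSD not claimed for any curve.  Sources: [GrossLMS1991] §3 (3.3)–(3.7), §4
(4.1)–(4.3); [McCallumLMS1991] §4 (4); [HuShuYin2019] §2 Prop. 2.4, §4.1; memo g44 §4.
`lean search 'levelDataHalved'` → nothing before this file.
-/

set_option linter.dupNamespace false -- Summits modules are `Summit.<Summit>.<Problem>…` by design
set_option autoImplicit false

noncomputable section

open scoped Classical

namespace Summit.BirchSwinnertonDyer.BirchSwinnertonDyer.Theorems.SylvesterTwoCMFlip

open WeierstrassCurve Field NumberField IsDedekindDomain Finset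
open Literature.NumberTheory.EllipticCurves Literature.NumberTheory.GaloisRepresentations
  Literature.NumberTheory.EllipticCurves.ModularForms
  Literature.NumberTheory.EllipticCurves.HuShuYin2019
  Literature.NumberTheory.EllipticCurves.KolyvaginCocycle
  Literature.NumberTheory.EllipticCurves.RingClassField
  Summit.BirchSwinnertonDyer.BirchSwinnertonDyer.Theorems.SylvesterTwoCMData
  Summit.BirchSwinnertonDyer.BirchSwinnertonDyer.Theorems.SylvesterTwoCMHalf
  Summit.BirchSwinnertonDyer.Rank1Residual.X11b.RingClassTower
  Summit.BirchSwinnertonDyer.Rank1Residual.X11b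

variable {K : Type} [Field K] [NumberField K]

set_option maxHeartbeats 1600000 in
/-- ★ **THE LEVEL DATA OF THE HALVED CLASS TERM at a general square-free conductor `9p·n₀`** (RESIDUE 7′ (T-L1),
class term; S1's twin on the HALF transversal).  Inputs: S1's global data (`K ∋ ω` quadratic, `p ≡ 1 (3)` prime, `Dt`;
the frame transport `κ`; the coupled frame `v_B, v_A, ψ_B, ψ_A, ρ`; the bottom embedding `emb₀ : K[9p] → K̄` and its
fixer `N₀`), THE HALF FIXER (`N″ ⊇ N₀` with the dichotomy w.r.t. an involution `s` of `K[9p]/K`, fixing `v_B, v_A`;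
a family `t` BIJECTIVE onto `Γ_K ⧸ N″` — the outputs of `SylvesterTwoCMHalf.exists_halfFixer`), S1's level data
(`n₀` square-free, `N = 9p·n₀`, coherent `emb`, point map `ιe`, fixer `N`, the list `l` of `(σ_q, q)`, `2^M ∣ q+1`,
the CM point `y` over `φ(τ_{Q^{(n₀)}})`) AND THE TOWER FIXING at level `N` (`φ ∈ Aut_K K[N]` restricting to `s`,
`φ·y = y`; displayed, not proved).  Output, for `P := κ⁻¹ ιe(D_l y)`: S1's conjuncts (commuting generators of order
`∣ q+1`, (ES1), `P ∈ E₉(K̄)^N`, (R5) on `N₀`, `N ⊴ Γ_K`, cube roots fixed, admissibility at `2^M`), (R5)″ on `N″`,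
and the HALF χ-components `ψ_B(Σᵢ ρ_{tᵢ}(tᵢ•P))`, `ψ_A(Σᵢ ρ²_{tᵢ}(tᵢ•P))` in `invPoints`.
[cite: GrossLMS1991, §3 (3.3)–(3.7), §4 (4.1)–(4.3)] [cite: McCallumLMS1991, §4 (4)]
[cite: HuShuYin2019, §2 Prop. 2.4, §4.1] -/
theorem levelDataHalved_sylvesterTower {ω : K} (hω : ω ^ 2 + ω + 1 = 0) (h2 : Module.finrank ℚ K = 2)
    (ι : K →+* ℂ) [(⟨0, 0, 1, 0, -1⟩ : WeierstrassCurve ℚ).IsElliptic] [(⟨0, 0, 1, 0, -1⟩ : WeierstrassCurve ℚ).IsGloballyMinimal]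
    (Dt : ModularParametrizationData (⟨0, 0, 1, 0, -1⟩ : WeierstrassCurve ℚ) 243) {p : ℕ} (hp : p.Prime) (hp3 : p % 3 = 1)
    {n₀ N : ℕ} (hsq : Squarefree n₀) (hN : 9 * p * n₀ = N)
    -- the frame transport `E₉(K̄) ≃+ W₀(K̄)`
    (κ : geomPoints ((cubeSumCurve 9).baseChange K) ≃+ geomPoints ((⟨0, 0, 1, 0, -1⟩ : WeierstrassCurve ℚ).baseChange K))
    (hκG : ∀ (g : absoluteGaloisGroup K) (P : geomPoints ((cubeSumCurve 9).baseChange K)), κ (g • P) = g • κ P)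
    -- the coupled frame (`exists_coupledFrame`)
    {vB vA : AlgebraicClosure K} (hvBc : vB ^ 3 = algebraMap ℚ (AlgebraicClosure K) ((p : ℚ) / 9))
    (hvB : vB ≠ 0) (hvAc : vA ^ 3 = algebraMap ℚ (AlgebraicClosure K) ((p : ℚ) ^ 2 / 3)) (hvA0 : vA ≠ 0)
    (hvB3 : ∀ g : absoluteGaloisGroup K, ((show AlgebraicClosure K ≃ₐ[K] AlgebraicClosure K from g) vB) ^ 3 = vB ^ 3)
    (hvA3 : ∀ g : absoluteGaloisGroup K, ((show AlgebraicClosure K ≃ₐ[K] AlgebraicClosure K from g) vA) ^ 3 = vA ^ 3)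
    {ψB : geomPoints ((cubeSumCurve 9).baseChange K) ≃+ geomPoints ((cubeSumCurve (p : ℚ)).baseChange K)}
    {ψA : geomPoints ((cubeSumCurve 9).baseChange K) ≃+ geomPoints ((cubeSumCurve (3 * (p : ℚ) ^ 2)).baseChange K)}
    {ρ : absoluteGaloisGroup K → geomPoints ((cubeSumCurve 9).baseChange K) ≃+ geomPoints ((cubeSumCurve 9).baseChange K)}
    (hρ : ∀ (g : absoluteGaloisGroup K) {x y : AlgebraicClosure K}
        (h : (((cubeSumCurve 9).baseChange K).baseChange (AlgebraicClosure K)).toAffine.Nonsingular x y),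
        ∃ h', ρ g (Affine.Point.some x y h) =
          Affine.Point.some (((show AlgebraicClosure K ≃ₐ[K] AlgebraicClosure K from g) vB / vB) ^ 2 * x) y h')
    (hρρ : ∀ (g : absoluteGaloisGroup K) {x y : AlgebraicClosure K}
        (h : (((cubeSumCurve 9).baseChange K).baseChange (AlgebraicClosure K)).toAffine.Nonsingular x y),
        ∃ h', ρ g (ρ g (Affine.Point.some x y h)) =
          Affine.Point.some (((show AlgebraicClosure K ≃ₐ[K] AlgebraicClosure K from g) vA / vA) ^ 2 * x) y h')
    (hlawB : ∀ (g : absoluteGaloisGroup K) (P : geomPoints ((cubeSumCurve 9).baseChange K)), g • ψB P = ψB (ρ g (g • P)))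
    (hlawA : ∀ (g : absoluteGaloisGroup K) (P : geomPoints ((cubeSumCurve 9).baseChange K)),
        g • ψA P = ψA (ρ g (ρ g (g • P))))
    -- the bottom embedding and its fixer
    (emb₀ : ringClassField K ι (9 * p) →+* AlgebraicClosure K)
    (hemb₀ : ∀ k : K, emb₀ (algebraMap K (ringClassField K ι (9 * p)) k) = algebraMap K (AlgebraicClosure K) k)
    (N₀ : Subgroup (absoluteGaloisGroup K))
    (hN₀ : ∀ g : absoluteGaloisGroup K, g ∈ N₀ ↔
      ∀ x : ringClassField K ι (9 * p), (show AlgebraicClosure K ≃ₐ[K] AlgebraicClosure K from g) (emb₀ x) = emb₀ x)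
    -- THE HALF FIXER: `N″ ⊇ N₀`, the dichotomy w.r.t. the bottom involution `s`, `N″` fixes `v_B, v_A`,
    -- and a HALF transversal `t` — representatives of `Γ_K ⧸ N″` (`exists_halfFixer`)
    (s : ringClassField K ι (9 * p) ≃ₐ[K] ringClassField K ι (9 * p)) (hs2 : s * s = 1)
    (N'' : Subgroup (absoluteGaloisGroup K)) (hN''₀ : ∀ g ∈ N₀, g ∈ N'')
    (hdich : ∀ g ∈ N'', (∀ x : ringClassField K ι (9 * p),
        (show AlgebraicClosure K ≃ₐ[K] AlgebraicClosure K from g) (emb₀ x) = emb₀ x) ∨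
      (∀ x : ringClassField K ι (9 * p),
        (show AlgebraicClosure K ≃ₐ[K] AlgebraicClosure K from g) (emb₀ x) = emb₀ (s x)))
    (hN''vB : ∀ g ∈ N'', (show AlgebraicClosure K ≃ₐ[K] AlgebraicClosure K from g) vB = vB)
    (hN''vA : ∀ g ∈ N'', (show AlgebraicClosure K ≃ₐ[K] AlgebraicClosure K from g) vA = vA)
    {ιt : Type} [Fintype ιt] (t : ιt → absoluteGaloisGroup K)
    (ht : Function.Bijective fun i ↦ (t i : absoluteGaloisGroup K ⧸ N''))
    -- the level `K[N]`: coherent embedding, point map, fixer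
    (hle₀ : ringClassField K ι (9 * p) ≤ ringClassField K ι N)
    (emb : ringClassField K ι N →+* AlgebraicClosure K)
    (hemb : ∀ k : K, emb (algebraMap K (ringClassField K ι N) k) = algebraMap K (AlgebraicClosure K) k)
    (hcoh₀ : ∀ x : ringClassField K ι (9 * p), emb (RingClassField.inclusion ι hle₀ x) = emb₀ x)
    (ιe : letI : DecidableEq (ringClassField K ι N) := fun a b ↦ Classical.propDecidable (a = b)
      ((⟨0, 0, 1, 0, -1⟩ : WeierstrassCurve ℚ).baseChange (ringClassField K ι N)).toAffine.Point →+ geomPoints ((⟨0, 0, 1, 0, -1⟩ : WeierstrassCurve ℚ).baseChange K))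
    (hιe : ∀ P, ιe P = Affine.Point.map (W' := (⟨0, 0, 1, 0, -1⟩ : WeierstrassCurve ℚ)) emb.toRatAlgHom P)
    (Nf : Subgroup (absoluteGaloisGroup K))
    (hNf : ∀ g : absoluteGaloisGroup K, g ∈ Nf ↔
      ∀ x : ringClassField K ι N, (show AlgebraicClosure K ≃ₐ[K] AlgebraicClosure K from g) (emb x) = emb x)
    -- the generators along the prime factors of `n₀`
    (l : List ((ringClassField K ι N ≃ₐ[ℚ] ringClassField K ι N) × ℕ))
    (hlmem : ∀ a ∈ l, a.2 ∈ n₀.primeFactors) (hcover : ∀ q ∈ n₀.primeFactors, ∃ a ∈ l, a.2 = q)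
    (hl3 : ∀ a ∈ l, a.2 % 3 = 2) (hl2 : ∀ a ∈ l, a.2 ≠ 2)
    (hgen : ∀ a ∈ l, Subgroup.zpowers a.1 = ringClassGalOver ι N (N / a.2))
    {M : ℕ} (nl : ℕ) (hn : nl = 2 ^ M) (hdvd : ∀ a ∈ l, 2 ^ M ∣ a.2 + 1)
    -- the CM point of conductor `9p·n₀`
    {y : ((⟨0, 0, 1, 0, -1⟩ : WeierstrassCurve ℚ).baseChange (ringClassField K ι N)).toAffine.Point}
    (hy : Affine.Point.map (W' := (⟨0, 0, 1, 0, -1⟩ : WeierstrassCurve ℚ)) (ringClassField K ι N).subtype.toRatAlgHom y =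
      Dt.φ (heegnerTau ((n₀ : ℤ) ^ 2 * (81 * ((p : ℤ) ^ 2 + 4 * p + 16)),
        (n₀ : ℤ) * (-(9 * (4 * (p : ℤ) ^ 2 + 17 * p + 72))), 4 * (p : ℤ) ^ 2 + 18 * p + 81)))
    -- THE TOWER FIXING at the level `N` (W2-b; displayed, not proved): `φ` restricts to `s` and FIXES `y`
    (φ : ringClassField K ι N ≃ₐ[K] ringClassField K ι N)
    (hφs : ∀ x : ringClassField K ι (9 * p),
      φ (RingClassField.inclusion ι hle₀ x) = RingClassField.inclusion ι hle₀ (s x))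
    (hφy : pointGalHom (⟨0, 0, 1, 0, -1⟩ : WeierstrassCurve ℚ) (ringClassField K ι N) (φ.restrictScalars ℚ) y = y) :
    (∀ a ∈ l, ∀ b ∈ l, Commute a.1 b.1) ∧ (∀ a ∈ l, a.1 ^ (a.2 + 1) = 1) ∧
    (∀ a ∈ l, ∑ i ∈ Finset.range (a.2 + 1), pointGalHom (⟨0, 0, 1, 0, -1⟩ : WeierstrassCurve ℚ) (ringClassField K ι N) (a.1 ^ i) y = 0) ∧
    κ.symm (ιe (l.foldr (fun b z ↦ KolyvaginOperator.derivOp (pointGalHom (⟨0, 0, 1, 0, -1⟩ : WeierstrassCurve ℚ) (ringClassField K ι N)) b.1 b.2 z) y)) ∈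
      FixedPoints.addSubgroup Nf (geomPoints ((cubeSumCurve 9).baseChange K)) ∧
    (∀ h ∈ N₀, ∃ a ∈ FixedPoints.addSubgroup Nf (geomPoints ((cubeSumCurve 9).baseChange K)),
      ((nl : ℕ) : ℤ) • a =
        h • κ.symm (ιe (l.foldr (fun b z ↦ KolyvaginOperator.derivOp (pointGalHom (⟨0, 0, 1, 0, -1⟩ : WeierstrassCurve ℚ) (ringClassField K ι N)) b.1 b.2 z) y)) -
          κ.symm (ιe (l.foldr (fun b z ↦ KolyvaginOperator.derivOp (pointGalHom (⟨0, 0, 1, 0, -1⟩ : WeierstrassCurve ℚ) (ringClassField K ι N)) b.1 b.2 z) y))) ∧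
    Nf.Normal ∧
    (∀ h ∈ N₀, (show AlgebraicClosure K ≃ₐ[K] AlgebraicClosure K from h) vB = vB) ∧
    (∀ h ∈ N₀, (show AlgebraicClosure K ≃ₐ[K] AlgebraicClosure K from h) vA = vA) ∧
    (∀ h ∈ Nf, (show AlgebraicClosure K ≃ₐ[K] AlgebraicClosure K from h) vB = vB) ∧
    IsAdmissible (absoluteGaloisGroup K)
      ((FixedPoints.addSubgroup Nf (geomPoints ((cubeSumCurve 9).baseChange K))).map ψB.toAddMonoidHom) ((nl : ℕ) : ℤ) ∧
    IsAdmissible (absoluteGaloisGroup K)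
      ((FixedPoints.addSubgroup Nf (geomPoints ((cubeSumCurve 9).baseChange K))).map ψA.toAddMonoidHom) ((nl : ℕ) : ℤ) ∧
    -- (R5)″ on the half fixer `N″`
    (∀ h ∈ N'', ∃ a ∈ FixedPoints.addSubgroup Nf (geomPoints ((cubeSumCurve 9).baseChange K)),
      ((nl : ℕ) : ℤ) • a =
        h • κ.symm (ιe (l.foldr (fun b z ↦ KolyvaginOperator.derivOp (pointGalHom (⟨0, 0, 1, 0, -1⟩ : WeierstrassCurve ℚ) (ringClassField K ι N)) b.1 b.2 z) y)) -
          κ.symm (ιe (l.foldr (fun b z ↦ KolyvaginOperator.derivOp (pointGalHom (⟨0, 0, 1, 0, -1⟩ : WeierstrassCurve ℚ) (ringClassField K ι N)) b.1 b.2 z) y))) ∧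
    -- the HALF χ-components are `Γ_K`-invariant modulo `nl = 2^M`
    ψB (∑ i, ρ (t i) (t i • κ.symm (ιe (l.foldr (fun b z ↦ KolyvaginOperator.derivOp (pointGalHom (⟨0, 0, 1, 0, -1⟩ : WeierstrassCurve ℚ) (ringClassField K ι N)) b.1 b.2 z) y)))) ∈
      invPoints (absoluteGaloisGroup K)
        ((FixedPoints.addSubgroup Nf (geomPoints ((cubeSumCurve 9).baseChange K))).map ψB.toAddMonoidHom) ((nl : ℕ) : ℤ) ∧
    ψA (∑ i, ρ (t i) (ρ (t i) (t i • κ.symm (ιe (l.foldr (fun b z ↦ KolyvaginOperator.derivOp (pointGalHom (⟨0, 0, 1, 0, -1⟩ : WeierstrassCurve ℚ) (ringClassField K ι N)) b.1 b.2 z) y))))) ∈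
      invPoints (absoluteGaloisGroup K)
        ((FixedPoints.addSubgroup Nf (geomPoints ((cubeSumCurve 9).baseChange K))).map ψA.toAddMonoidHom) ((nl : ℕ) : ℤ) := by
  subst hn
  have hK := JZero.isImaginaryQuadratic_of_sq_add_self_add_one hω h2
  have hdK := JZero.discr_eq_neg_three_of_sq_add_self_add_one hω h2
  have hp0 : p ≠ 0 := hp.ne_zero
  have hp2 : p ≠ 2 := by rintro rfl; norm_num at hp3
  have hn₀ : n₀ ≠ 0 := hsq.ne_zero
  have h9p : 9 * p ≠ 0 := mul_ne_zero (by norm_num) hp0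
  have hN0 : N ≠ 0 := by rw [← hN]; exact mul_ne_zero h9p hn₀
  -- every prime factor `q` of `n₀` is `≡ 2 (3)` and `≠ 2`
  have hq3 : ∀ q ∈ n₀.primeFactors, q % 3 = 2 := fun q hq ↦ by
    obtain ⟨a, ha, rfl⟩ := hcover q hq; exact hl3 a ha
  have hq2 : ∀ q ∈ n₀.primeFactors, q ≠ 2 := fun q hq ↦ by
    obtain ⟨a, ha, rfl⟩ := hcover q hq; exact hl2 a ha
  have h3n₀ : ¬ 3 ∣ n₀ := fun h ↦ by
    have := hq3 3 (Nat.mem_primeFactors.mpr ⟨Nat.prime_three, h, hn₀⟩); omega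
  have hpn₀ : ¬ p ∣ n₀ := fun h ↦ by
    have := hq3 p (Nat.mem_primeFactors.mpr ⟨hp, h, hn₀⟩); omega
  have h2n₀ : ¬ 2 ∣ n₀ := fun h ↦ hq2 2 (Nat.mem_primeFactors.mpr ⟨Nat.prime_two, h, hn₀⟩) rfl
  have hn₀odd : Odd n₀ := Nat.odd_iff.mpr (Nat.two_dvd_ne_zero.mp h2n₀)
  have hpodd : Odd p := hp.eq_two_or_odd'.resolve_left hp2
  have hcop : Nat.Coprime n₀ (9 * p) := by
    refine Nat.Coprime.mul_right ?_ ?_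
    · exact Nat.Coprime.pow_right 2 ((Nat.Prime.coprime_iff_not_dvd Nat.prime_three).mpr h3n₀).symm
    · exact ((Nat.Prime.coprime_iff_not_dvd hp).mpr hpn₀).symm
  -- the generators commute and have order dividing `q + 1`
  have hc : ∀ a ∈ l, ∀ b ∈ l, Commute a.1 b.1 := fun a ha b hb ↦
    commute_of_zpowers_eq_ringClassGalOver hK ι hN0 (hgen a ha) (hgen b hb)
  have hord : ∀ a ∈ l, a.1 ^ (a.2 + 1) = 1 := by
    intro a ha
    have hq := hlmem a ha
    have hqp : a.2.Prime := Nat.prime_of_mem_primeFactors hq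
    have hqn₀ : a.2 ∣ n₀ := Nat.dvd_of_mem_primeFactors hq
    have hinert := JZero.span_natCast_isPrime_of_mod_three_eq_two hω h2 hqp (hl3 a ha)
    have hqN : a.2 ∣ N := hN ▸ hqn₀.trans (Dvd.intro_left _ rfl)
    have hq9p : ¬ a.2 ∣ 9 * p := fun h ↦ by
      have := Nat.Coprime.eq_one_of_dvd (Nat.Coprime.coprime_dvd_left hqn₀ hcop) h
      exact hqp.one_lt.ne' this
    have hdiv : N / a.2 = 9 * p * (n₀ / a.2) := by
      subst hN; exact Nat.mul_div_assoc _ hqn₀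
    have hqN' : ¬ a.2 ∣ N / a.2 := by
      rw [hdiv]
      intro h
      rcases (Nat.Prime.dvd_mul hqp).mp h with h' | h'
      · exact hq9p h'
      · have : a.2 * a.2 ∣ n₀ := by
          have e := Nat.mul_div_cancel' hqn₀
          rw [← e]; exact Nat.mul_dvd_mul_left _ h'
        exact hqp.one_lt.ne' (Nat.isUnit_iff.mp (hsq _ this))
    have hunits : 2 ≤ N / a.2 ∨ NumberField.discr K < -4 := by
      left; rw [hdiv]
      have : 1 ≤ p * (n₀ / a.2) := Nat.one_le_iff_ne_zero.mpr
        (mul_ne_zero hp0 (Nat.div_ne_zero_iff_of_dvd hqn₀ |>.mpr ⟨hn₀, hqp.ne_zero⟩))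
      nlinarith
    exact pow_succ_eq_one_of_zpowers_eq_ringClassGalOver hK ι hqp hinert hqN hqN' hN0 hunits (hgen a ha)
  -- (ES1) along the list
  have htr : ∀ a ∈ l, ∑ i ∈ Finset.range (a.2 + 1),
      pointGalHom (⟨0, 0, 1, 0, -1⟩ : WeierstrassCurve ℚ) (ringClassField K ι N) (a.1 ^ i) y = 0 := by
    intro a ha
    have hq := hlmem a ha
    have hqp : a.2.Prime := Nat.prime_of_mem_primeFactors hq
    have hqn₀ : a.2 ∣ n₀ := Nat.dvd_of_mem_primeFactors hq
    have e : n₀ = a.2 * (n₀ / a.2) := (Nat.mul_div_cancel' hqn₀).symm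
    have hm : n₀ / a.2 ≠ 0 := (Nat.div_ne_zero_iff_of_dvd hqn₀).mpr ⟨hn₀, hqp.ne_zero⟩
    have hm3 : ∀ r ∈ (n₀ / a.2).primeFactors, r % 3 = 2 := fun r hr ↦
      hq3 r (Nat.primeFactors_mono (Nat.div_dvd_of_dvd hqn₀) hn₀ hr)
    have hqm : ¬ a.2 ∣ n₀ / a.2 := fun h' ↦ by
      have : a.2 * a.2 ∣ n₀ := by rw [e]; exact Nat.mul_dvd_mul_left _ h'
      exact hqp.one_lt.ne' (Nat.isUnit_iff.mp (hsq _ this))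
    have hqp' : ¬ a.2 ∣ p := fun h' ↦ by
      have := (Nat.prime_dvd_prime_iff_eq hqp hp).mp h'
      have h3 := hl3 a ha; rw [this] at h3; omega
    have hN' : 9 * p * (a.2 * (n₀ / a.2)) = N := by rw [← e]; exact hN
    have hdiv : N / a.2 = 9 * p * (n₀ / a.2) := by
      subst hN; exact Nat.mul_div_assoc _ hqn₀
    have hσ : Subgroup.zpowers a.1 = ringClassGalOver ι N (9 * p * (n₀ / a.2)) := by
      rw [hgen a ha, hdiv]
    have hy' := hy
    rw [e] at hy'
    exact sum_pointGalHom_pow_eq_zero_of_level hω h2 ι Dt hp3 hN' hqp (hl3 a ha) (hl2 a ha) hm hm3 hqm hqp' hσ hy'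
  -- the fixer `N₀` read at the level `N`; `N ≤ N₀ ≤ N″`
  have hN₀' := mem_iff_forall_mem_nine_mul ι hle₀ emb₀ emb hcoh₀ hN₀
  have hNfN₀ : Nf ≤ N₀ := le_of_mem_iff_of_mem_iff_forall emb hNf hN₀'
  -- `P ∈ E₉(K̄)^N` and (R5) on `N₀`
  have hPN := mem_fixedPoints_symm_of_equivariant κ hκG Nf
    (map_emb_mem_fixedPoints (⟨0, 0, 1, 0, -1⟩ : WeierstrassCurve ℚ) ι emb ιe hιe Nf hNf
      (l.foldr (fun b z ↦ KolyvaginOperator.derivOp (pointGalHom (⟨0, 0, 1, 0, -1⟩ : WeierstrassCurve ℚ) (ringClassField K ι N)) b.1 b.2 z) y))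
  -- (T16) is stated for the `Classical.propDecidable` equality instance on `K[N]`; the sums and derivative
  -- operators here use the ambient instance — the two agree by `Subsingleton (DecidableEq _)`
  have hinst : (fun a b ↦ Classical.propDecidable (a = b) : DecidableEq (ringClassField K ι N)) =
      (inferInstance : DecidableEq (ringClassField K ι N)) := Subsingleton.elim _ _
  have hP : ∀ h ∈ N₀, ∃ a ∈ FixedPoints.addSubgroup Nf (geomPoints ((cubeSumCurve 9).baseChange K)),
      ((2 ^ M : ℕ) : ℤ) • a =
        h • κ.symm (ιe (l.foldr (fun b z ↦ KolyvaginOperator.derivOp (pointGalHom (⟨0, 0, 1, 0, -1⟩ : WeierstrassCurve ℚ) (ringClassField K ι N)) b.1 b.2 z) y)) -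
          κ.symm (ιe (l.foldr (fun b z ↦ KolyvaginOperator.derivOp (pointGalHom (⟨0, 0, 1, 0, -1⟩ : WeierstrassCurve ℚ) (ringClassField K ι N)) b.1 b.2 z) y)) := by
    intro h hh
    have key := exists_fixedPoints_zsmul_eq_foldr_derivOp hK ι (⟨0, 0, 1, 0, -1⟩ : WeierstrassCurve ℚ) h9p hsq hcop
      hN emb hemb ιe hιe Nf hNf N₀ hN₀' l hcover hgen hc hord hdvd (by rw [hinst]; exact htr) hh
    rw [foldr_derivOp_eq_of_decEq (⟨0, 0, 1, 0, -1⟩ : WeierstrassCurve ℚ)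
      (fun a b ↦ Classical.propDecidable (a = b)) inferInstance l y] at key
    exact exists_fixedPoints_zsmul_eq_symm_of_equivariant κ hκG Nf key
  -- ### the curve/level package (S1's via `coupledFrame_levelPackage`, re-derived without a transversal of `Γ_K/N₀`)
  subst hN
  haveI := (finiteDimensional_and_isGalois_ringClassField hK ι hN0).1
  haveI := (finiteDimensional_and_isGalois_ringClassField hK ι hN0).2
  haveI hNn : Nf.Normal := normal_of_mem_iff emb hemb Nf hNf
  have hN₀vB : ∀ h ∈ N₀, (show AlgebraicClosure K ≃ₐ[K] AlgebraicClosure K from h) vB = vB :=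
    fun h hh ↦ hN''vB h (hN''₀ h hh)
  have hN₀vA : ∀ h ∈ N₀, (show AlgebraicClosure K ≃ₐ[K] AlgebraicClosure K from h) vA = vA :=
    fun h hh ↦ hN''vA h (hN''₀ h hh)
  have hNvB : ∀ h ∈ Nf, (show AlgebraicClosure K ≃ₐ[K] AlgebraicClosure K from h) vB = vB :=
    fun h hh ↦ hN₀vB h (hNfN₀ hh)
  have h6 := pow_three_ne_six_of_fix_sylvester_prime hK hdK ι hpodd hn₀odd emb hemb Nf hNf
  have hρρ' : ∀ (g : absoluteGaloisGroup K) {x y : AlgebraicClosure K}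
      (h : (((cubeSumCurve 9).baseChange K).baseChange (AlgebraicClosure K)).toAffine.Nonsingular x y),
      ∃ h', (fun g ↦ (ρ g).trans (ρ g)) g (Affine.Point.some x y h) =
        Affine.Point.some (((show AlgebraicClosure K ≃ₐ[K] AlgebraicClosure K from g) vA / vA) ^ 2 * x)
          y h' := fun g x y h ↦ hρρ g h
  have hlawA' : ∀ (g : absoluteGaloisGroup K) (P : geomPoints ((cubeSumCurve 9).baseChange K)),
      g • ψA P = ψA ((fun g ↦ (ρ g).trans (ρ g)) g (g • P)) := fun g P ↦ hlawA g P
  have hAB := isAdmissible_map_fixedPoints_cubeSumCurve_nine K hω hvB hvB3 hρ hlawB Nf h6 M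
  have hAA := isAdmissible_map_fixedPoints_cubeSumCurve_nine K hω hvA0 hvA3 hρρ' hlawA' Nf h6 M
  -- ### THE TOWER FIXING: a lift `φ̃ ∈ Γ_K` of `φ` acts as `s` on `emb₀ K[9p]` and FIXES `P = κ⁻¹ ιe(D_l y)`
  obtain ⟨φt, hφt⟩ := exists_lift_algEquiv emb hemb φ
  have hφt₀ : ∀ x : ringClassField K ι (9 * p),
      (show AlgebraicClosure K ≃ₐ[K] AlgebraicClosure K from φt) (emb₀ x) = emb₀ (s x) := fun x ↦ by
    rw [← hcoh₀, hφt, hφs, hcoh₀]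
  have hcommφ : ∀ a ∈ l, Commute (φ.restrictScalars ℚ) a.1 := by
    intro a ha
    have hφG : φ.restrictScalars ℚ ∈ ringClassGal ι (9 * p * n₀) :=
      (mem_ringClassGal_iff_forall_apply_algebraMap ι _ _).mpr fun k ↦ φ.commutes k
    have haG : a.1 ∈ ringClassGal ι (9 * p * n₀) :=
      ringClassGalOver_le_ringClassGal ι _ _ ((hgen a ha) ▸ Subgroup.mem_zpowers a.1)
    have h := (KolyvaginH44.isMulCommutative_ringClassGal' hK ι (9 * p * n₀)).is_comm.comm ⟨_, hφG⟩ ⟨_, haG⟩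
    exact congrArg Subtype.val h
  have hfin : pointGalHom (⟨0, 0, 1, 0, -1⟩ : WeierstrassCurve ℚ) (ringClassField K ι (9 * p * n₀))
      (φ.restrictScalars ℚ) (l.foldr (fun b z ↦ KolyvaginOperator.derivOp
        (pointGalHom (⟨0, 0, 1, 0, -1⟩ : WeierstrassCurve ℚ) (ringClassField K ι (9 * p * n₀))) b.1 b.2 z) y) =
      l.foldr (fun b z ↦ KolyvaginOperator.derivOp
        (pointGalHom (⟨0, 0, 1, 0, -1⟩ : WeierstrassCurve ℚ) (ringClassField K ι (9 * p * n₀))) b.1 b.2 z) y := by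
    rw [pointGalHom_foldr_derivOp_comm _ l hcommφ, hφy]
  have hφP : φt • κ.symm (ιe (l.foldr (fun b z ↦ KolyvaginOperator.derivOp
      (pointGalHom (⟨0, 0, 1, 0, -1⟩ : WeierstrassCurve ℚ) (ringClassField K ι (9 * p * n₀))) b.1 b.2 z) y)) =
      κ.symm (ιe (l.foldr (fun b z ↦ KolyvaginOperator.derivOp
        (pointGalHom (⟨0, 0, 1, 0, -1⟩ : WeierstrassCurve ℚ) (ringClassField K ι (9 * p * n₀))) b.1 b.2 z) y)) :=
    smul_symm_embPoints_eq_of_apply_eq emb κ hκG ιe hιe (φ.restrictScalars ℚ) hφt hfin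
  -- ### (R5)″ on `N″` by the dichotomy, and the half χ-components
  have hP'' := exists_mem_zsmul_eq_smul_sub_of_dichotomy emb₀ hN₀ hs2 hdich hφt₀ hφP hP
  refine ⟨hc, hord, htr, hPN, hP, hNn, hN₀vB, hN₀vA, hNvB, hAB, hAA, hP'', ?_, ?_⟩
  · exact JZero.cubicTwist_chiComponent_fixedPoints_mem_invPoints hω hvB hvB3 hρ hlawB Nf hN''vB t ht hPN hP''
  · exact JZero.cubicTwist_chiComponent_fixedPoints_mem_invPoints hω hvA0 hvA3 hρρ' hlawA' Nf hN''vA t ht hPN hP''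

end Summit.BirchSwinnertonDyer.BirchSwinnertonDyer.Theorems.SylvesterTwoCMFlip

end
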